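import Summits.CriticalPhenomena.SAWScalingLimit.Theses.SAWSchrammPassage
import Summits.CriticalPhenomena.SAWScalingLimit.Theorems.SAWConePseudogroupLatticeSimilarityOfLimitTransport
import HarnessLib

/-!
# Crux `ClosureToSchramm` (stmt-CriticalPhenomena-5597, route SAWSchrammPassage) — the typed split

Glue theorem for the DECOMPOSITION of the crux
`Summit.CriticalPhenomena.SAWScalingLimit.Theses.SAWSchrammPassage.ClosureToSchramm :=
TurningClosure → SchrammPassageUniform` (rank 4 of route CriticalPhenomena/SAWSchrammPassage; the
weak turning closure of the SAW side field `h_δ` implies Schramm's `κ = 8/3` left-passage law,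
uniformly over cell domains) into THREE leaf statements, recorded by the crux-strategist seat
(BC2 redirect of the route re-audit 2026-08-17): `closureToSchramm_of_subs : A → B → E → ClosureToSchramm`
with the three hypotheses written in arrow form VERBATIM as the `statement`s filed with
`ledger route edit --split ClosureToSchramm` (children `SchrodingerStability`, `ArcBoundaryValues`,
`SideFieldEquicontinuity` of the route file).

CHILDREN.
* `A = SchrodingerStability` (PURE ANALYSIS, no self-avoiding walk in it): for all moduli
  `ηB, NB, ρE, NE` and every `ε > 0` there are FINITELY MANY test functions `ψ₁ … ψ_m ∈ C²_c(ℂ)`, a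
  margin `r`, a tolerance `η` and a room `N` such that: for every mesh `δ ≤ 1/N`, Dobrushin domain `D`,
  conformal `Φ : ℍ → D` and point `z` in NORMAL POSITION (`‖z‖ ≤ δ`, `dist(z, ∂D) = 1`, `‖Φ⁻¹ z‖ = 1`),
  EVERY function `H : ℂ → [0, 1]` which (i) has Schramm's boundary values near the two arcs with
  modulus `(ηB, NB)`, (ii) is macroscopically equicontinuous with modulus `(ρE, NE)` and (iii) nearly
  solves the discrete weak Schrödinger equation `|Σ_f H Δ_δψᵢ + ½ ψᵢ E (2H − 1)| ≤ η` for those `ψᵢ`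
  whose `r`-neighbourhood lies in `D` (`E = π²|∇_δ(arg Φ⁻¹/π)|²`), satisfies
  `|H z − (1 − index_D(z) Re Φ⁻¹ z)/2| ≤ ε`. Informal proof (not formalised): contradiction +
  compactness — bad instances with `δₙ → 0`; Koebe distortion and normal families for `Φₙ`
  (`dist = 1`, `‖Φₙ⁻¹ zₙ‖ = 1`, the case `arg Φₙ⁻¹ zₙ → 0, π` being settled by (i) directly),
  Carathéodory kernel convergence `Dₙ → D_∞`, a generalised Arzelà–Ascoli from (ii), passage of
  (iii) to the limit along a countable dense family of test functions, conformal invariance of the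
  weak equation `(Δ + π²|∇ω|²)(2h − 1) = 0`, elliptic regularity, and UNIQUENESS of bounded solutions
  of `u_tt + u_θθ + u = 0` on the strip `ℝ × (0, π)` with boundary values `∓index` (Fourier modes
  `sin mθ · e^{±√(m²−1)t}` unbounded for `m ≥ 2`, the zero mode `B sin θ` killed by `|u| ≤ 1`:
  `sup_θ (−cos θ + B sin θ) = √(1+B²)`), [Schramm2001Percolation, Pommerenke1992, Lawler2005].
* `B = ArcBoundaryValues` (SAW a-priori estimate, Beurling type): uniformly over cell configurations,
  `h_δ(x)` is within `e` of Schramm's value as soon as `x` has `NB(e)` cells of room and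
  `arg Φ⁻¹(x) ∉ (ηB(e), π − ηB(e))` (the walk does not squeeze between `x` and a conformally
  adjacent boundary arc). A consequence of `SchrammPassageUniform` itself.
* `E = SideFieldEquicontinuity` (SAW a-priori estimate, one-arm type): uniformly over cell
  configurations, `|h_δ(x) − h_δ(x')| ≤ e` when `x` has `NE(e)` cells of room and
  `‖x' − x‖ ≤ ρE(e) dist(x, ∂D)` (the walk visits a given mesoscopic ball with small probability;
  it also forbids a positive density on any given edge). A consequence of `SchrammPassageUniform`
  and the Koebe gradient bound for `arg Φ⁻¹`.

THE GLUE (this file, sorry-free). Given `A, B, E` and `TurningClosure`, fix `ε`; read the moduli off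
`B` and `E` (choice), take `A`'s finite data `(ψᵢ)_{i<m}, r, η, N₀` for them, and `TurningClosure` for
each `ψᵢ` (tolerance `η`, margin `r`) giving `δ₀(i)`; put `N = N₀ + 1 + Σᵢ ⌈δ₀(i)⁻¹⌉`. For a cell
configuration `(δ, S, p, p', q, q', D, Φ)` and `z` with `N δ ≤ d := dist(z, ∂D)`, `‖Φ⁻¹ z‖ = 1`,
NORMALISE by the lattice similarity `σ x = (x − δ v₀)/d`, `v₀` the site nearest to `z`: the image
configuration `(δ/d, S − v₀, p − v₀, …, σD, σ ∘ Φ)` is again a cell configuration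
(`image_simil_interior_cellSet`: octagons and filler diamonds are carried onto octagons and filler
diamonds of the mesh `δ/d`; marked points, adjacency and chordality are transported), `σz` is in
normal position (`infDist_simil_compl`, `dist_meshPoint_nearestSite_le`), `δ/d ≤ 1/N ≤ δ₀(i)`, and
the side field of the image configuration satisfies (i), (ii), (iii) by `B`, `E` and
`TurningClosure` APPLIED TO THE IMAGE CONFIGURATION (all three are uniform over cell configurations;
this is why the children are typed uniformly and why `A` is typed in normal position). `A` then bounds
the image side field at `σz`, and the EXACT SIMILARITY COVARIANCE of the side field
(`sideVal_simil`: `x ↦ x − v₀` is a graph isomorphism `D_δ ≃g (σD)_{δ/d}` of Smirnov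
discretisations by `discreteDomainGraph_dilate` ∘ `discreteDomainGraph_adj_vadd`; it induces a
length-preserving bijection of self-avoiding walks transporting `SAW.law`, `law_map_iso`; the closed
side loop of the image walk is `σ ∘` the side loop, `sideLoop_mapSAW`, and winding numbers are
invariant under `x ↦ c x`, `wind_const_mul`), of the Jordan index (`index_map_simil`) and of the
uniformizing coordinate (`Φ''⁻¹(σz) = Φ⁻¹ z`) carry the bound back to `z`.

HONESTY. The conjunction `A ∧ B ∧ E` is a priori STRONGER than the crux (as every split of an
implication into unconditional pieces must be): `B` and `E` are unconditional SAW statements implied by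
`SchrammPassageUniform`, `A` is an unconditional statement of analysis; none of the three is the crux
or the summit reworded (per-piece probes recorded in the strategist's census). No new `Prop`
definitions; the `def`s below (`sideLoop`, `sideVal`, `cellSet`, `simil`, `similIso`, `mapSAW`,
`mapUnif`) only NAME sub-terms of the route items for the proof.

References: O. Schramm, *A percolation formula*, Electron. Comm. Probab. 6 (2001)
[Schramm2001Percolation]; G. F. Lawler, O. Schramm, W. Werner, *On the scaling limit of planar
self-avoiding walk* (2004), §3.4.2 (similarity covariance of the critical SAW measure)
[LawlerSchrammWerner2004SAW]; V. Beffara, *Is critical 2D percolation universal?* (2008), §2.2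
(lattice symmetries) [Beffara2008]; Ch. Pommerenke, *Boundary behaviour of conformal maps* (1992),
§1.4 (Carathéodory kernel theorem) [Pommerenke1992]; G. F. Lawler, *Conformally invariant processes in
the plane* (2005), Ch. 3 (Koebe distortion) [Lawler2005]. All declarations [folklore].
-/

noncomputable section

open MeasureTheory Filter Topology Set
open scoped Pointwise
open Literature.Probability.LatticeModels Literature.Probability.RandomPlanarGeometry
open Literature.Topology.PlaneTopology
open Summit.CriticalPhenomena.SAWScalingLimit.Theses.SAWSchrammPassage
  (TurningClosure SchrammPassageUniform ClosureToSchramm)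
open Summit.CriticalPhenomena.SAWScalingLimit.Cruxes.HexTransfer.PinTheShear
  (toCurve_map_apply domainSAW_walk_injective)
open Summit.CriticalPhenomena.SAWScalingLimit.Theorems.LatticeSimilarityOfLimit
  (similarity_lineMap discreteDomainGraph_dilate)

namespace Summit.CriticalPhenomena.SAWScalingLimit.Theorems.ClosureToSchrammSplit

/-! ### Named gadgets: the closed side loop, the side field, Schramm's value, the cell set -/

/-- The closed loop `SAW polyline + [δq, pt 1] + arc 1 + [pt 0, δp]` of a SAW `γ` of `(D; p, q)` at mesh
`δ`, parametrised on `[0, 1]` exactly as inlined in the route items. [folklore] -/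
def sideLoop (δ : ℝ) (p q : Site 2) (D : DobrushinDomain) (γ : SAW.DomainSAW D.carrier δ p q)
    (t : ℝ) : ℂ :=
  if t ≤ 1 / 2 then (γ.walk.toCurve (meshPoint δ)) (Set.projIcc (0 : ℝ) 1 zero_le_one (2 * t))
  else if 2 * t - 1 ≤ 1 / 3 then meshPoint δ q + ((3 * (2 * t - 1) : ℝ) : ℂ) * (D.pt 1 - meshPoint δ q)
  else if 2 * t - 1 ≤ 2 / 3 then D.boundary (D.mark 1 + (3 * (2 * t - 1) - 1) * (D.mark 0 + 1 - D.mark 1))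
  else D.pt 0 + ((3 * (2 * t - 1) - 2 : ℝ) : ℂ) * (meshPoint δ p - D.pt 0)

/-- The side field `h_δ(x) = P_δ[wind(loop_γ, x) ≠ 0]` of the critical SAW of `(D; p, q)`. [folklore] -/
def sideVal (δ : ℝ) (p q : Site 2) (D : DobrushinDomain) (x : ℂ) : ℝ :=
  (SAW.law D.carrier δ p q {γ | wind (fun t => sideLoop δ p q D γ t - x) ≠ 0}).toReal

/-- The cell set of `S` at mesh `δ` (octagons + filler diamonds), whose interior is a cell domain. [folklore] -/
def cellSet (δ : ℝ) (S : Finset (Site 2)) : Set ℂ :=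
  {w : ℂ | ∃ v ∈ S, |w.re - (meshPoint δ v).re| ≤ δ / 2 ∧ |w.im - (meshPoint δ v).im| ≤ δ / 2 ∧
      |w.re - (meshPoint δ v).re| + |w.im - (meshPoint δ v).im| ≤ 9 * δ / 10} ∪
    {w : ℂ | ∃ v ∈ S, v + ![1, 0] ∈ S ∧ v + ![0, 1] ∈ S ∧ v + ![1, 1] ∈ S ∧
      |w.re - (meshPoint δ v).re - δ / 2| + |w.im - (meshPoint δ v).im - δ / 2| ≤ δ / 10}

/-! ### Generic helpers -/

/-- Multiplying a loop by a non-zero constant does not change its winding number (also in the junk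
cases: the two sides have logarithms, resp. closed up, simultaneously). [folklore] -/
theorem wind_const_mul {c : ℂ} (hc : c ≠ 0) (f : ℝ → ℂ) :
    wind (fun t => c * f t) = wind f := by
  classical
  obtain ⟨a, ha⟩ : ∃ a : ℂ, Complex.exp a = c := ⟨Complex.log c, Complex.exp_log hc⟩
  by_cases h : HasLogOn f (Icc 0 1) ∧ f 0 = f 1
  · obtain ⟨l, hl, hle⟩ := h.1
    have e1 := wind_spec hl hle h.2
    have hl' : ContinuousOn (fun t => a + l t) (Icc 0 1) := continuousOn_const.add hl
    have hle' : ∀ t ∈ Icc (0 : ℝ) 1, Complex.exp (a + l t) = c * f t := fun t ht => by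
      rw [Complex.exp_add, ha, hle t ht]
    have e2 := wind_spec (f := fun t => c * f t) hl' hle' (by simp only [h.2])
    have : l 1 - l 0 = wind (fun t => c * f t) * (2 * Real.pi * Complex.I) := by
      rw [← e2]; ring
    exact (int_eq_of_mul_two_pi_I_eq (this.symm.trans e1)).symm ▸ rfl
  · have h' : ¬ (HasLogOn (fun t => c * f t) (Icc 0 1) ∧ c * f 0 = c * f 1) := by
      rintro ⟨⟨l, hl, hle⟩, h01⟩
      refine h ⟨⟨fun t => l t - a, hl.sub continuousOn_const, fun t ht => ?_⟩, ?_⟩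
      · rw [Complex.exp_sub, hle t ht, ha, mul_div_cancel_left₀ _ hc]
      · exact mul_left_cancel₀ hc h01
    rw [wind, dif_neg h', wind, dif_neg h]

/-- The critical SAW law gives mass at most one to every event (also in the junk cases). [folklore] -/
theorem law_apply_le_one {Ω : Set ℂ} {δ : ℝ} {a b : Site 2} (A : Set (SAW.DomainSAW Ω δ a b)) :
    SAW.law Ω δ a b A ≤ 1 := by
  rw [SAW.law, Measure.smul_apply, smul_eq_mul]
  have hA : SAW.weight Ω δ a b A ≤ SAW.weight Ω δ a b univ := measure_mono (subset_univ _)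
  rcases eq_or_ne (SAW.weight Ω δ a b univ) 0 with h0 | h0
  · rw [h0] at hA
    rw [le_antisymm hA bot_le, mul_zero]
    exact zero_le_one
  rcases eq_or_ne (SAW.weight Ω δ a b univ) ⊤ with ht | ht
  · rw [ht, ENNReal.inv_top, zero_mul]
    exact zero_le_one
  calc (SAW.weight Ω δ a b univ)⁻¹ * SAW.weight Ω δ a b A
      ≤ (SAW.weight Ω δ a b univ)⁻¹ * SAW.weight Ω δ a b univ := by gcongr
    _ = 1 := ENNReal.inv_mul_cancel h0 ht

/-- `0 ≤ h_δ ≤ 1`. [folklore] -/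
theorem sideVal_mem (δ : ℝ) (p q : Site 2) (D : DobrushinDomain) (x : ℂ) :
    0 ≤ sideVal δ p q D x ∧ sideVal δ p q D x ≤ 1 :=
  ⟨ENNReal.toReal_nonneg, by
    have := ENNReal.toReal_mono ENNReal.one_ne_top (law_apply_le_one
      (Ω := D.carrier) (δ := δ) (a := p) (b := q) {γ | wind (fun t => sideLoop δ p q D γ t - x) ≠ 0})
    simpa [sideVal] using this⟩

/-! ### The normalising lattice similarity `x ↦ (x - δ v₀) / d` -/

section Similarity

variable {d : ℝ}

/-- `(d⁻¹ : ℝ)` as a non-zero complex number. [folklore] -/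
theorem kappa_ne_zero (hd : 0 < d) : ((d⁻¹ : ℝ) : ℂ) ≠ 0 :=
  Complex.ofReal_ne_zero.2 (inv_ne_zero hd.ne')

/-- The similarity `x ↦ d⁻¹ (x - δ v₀)` of the plane (dilation by `d⁻¹` after the lattice translation
by `-δ v₀`). [folklore] -/
def simil (d δ : ℝ) (v₀ : Site 2) (hd : 0 < d) : ℂ ≃ₜ ℂ :=
  similarity ((d⁻¹ : ℝ) : ℂ) (kappa_ne_zero hd) (-(((d⁻¹ : ℝ) : ℂ) * meshPoint δ v₀))

variable (hd : 0 < d) (δ : ℝ) (v₀ : Site 2)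

/-- Pointwise formula: `σ x = d⁻¹ (x - δ v₀)`. [folklore] -/
theorem simil_apply (x : ℂ) :
    simil d δ v₀ hd x = ((d⁻¹ : ℝ) : ℂ) * (x - meshPoint δ v₀) := by
  rw [simil, similarity_apply]; ring

/-- Real part of `σ x`. [folklore] -/
theorem simil_apply_re (x : ℂ) : (simil d δ v₀ hd x).re = d⁻¹ * (x.re - δ * v₀ 0) := by
  rw [simil_apply, Complex.re_ofReal_mul, Complex.sub_re, meshPoint_re]

/-- Imaginary part of `σ x`. [folklore] -/
theorem simil_apply_im (x : ℂ) : (simil d δ v₀ hd x).im = d⁻¹ * (x.im - δ * v₀ 1) := by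
  rw [simil_apply, Complex.im_ofReal_mul, Complex.sub_im, meshPoint_im]

/-- `Site.toComplex` is additive (subtraction). [folklore] -/
theorem toComplex_sub (x y : Site 2) : Site.toComplex (x - y) = Site.toComplex x - Site.toComplex y :=
  Complex.ext (by simp [Site.toComplex]) (by simp [Site.toComplex])

/-- The similarity maps the lattice `δℤ²` onto the lattice `(δ/d)ℤ²`, relabelled by `x ↦ x - v₀`.
[folklore] -/
theorem simil_meshPoint (x : Site 2) :
    simil d δ v₀ hd (meshPoint δ x) = meshPoint (δ * d⁻¹) (x - v₀) := by
  rw [simil_apply, meshPoint, meshPoint, meshPoint, toComplex_sub]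
  push_cast
  ring

/-- Differences are multiplied by `d⁻¹`. [folklore] -/
theorem simil_sub (x y : ℂ) :
    simil d δ v₀ hd x - simil d δ v₀ hd y = ((d⁻¹ : ℝ) : ℂ) * (x - y) := by
  rw [simil_apply, simil_apply]; ring

/-- The similarity is affine. [folklore] -/
theorem simil_affine (a b : ℂ) (s : ℂ) :
    simil d δ v₀ hd a + s * (simil d δ v₀ hd b - simil d δ v₀ hd a) =
      simil d δ v₀ hd (a + s * (b - a)) := by
  simp only [simil_apply]; ring

/-- Distances to (the complement of) a set scale by `d⁻¹`. [folklore] -/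
theorem infDist_simil_image (z : ℂ) (A : Set ℂ) :
    Metric.infDist (simil d δ v₀ hd z) (simil d δ v₀ hd '' A) = d⁻¹ * Metric.infDist z A := by
  have h1 : simil d δ v₀ hd '' A = ((d⁻¹ : ℝ) : ℂ) • ((fun x => x - meshPoint δ v₀) '' A) := by
    rw [← Set.image_smul, Set.image_image]
    exact Set.image_congr fun x _ => by rw [simil_apply, smul_eq_mul]
  have h2 : simil d δ v₀ hd z = ((d⁻¹ : ℝ) : ℂ) • (z - meshPoint δ v₀) := by
    rw [simil_apply, smul_eq_mul]
  have hiso : Isometry (fun x : ℂ => x - meshPoint δ v₀) :=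
    Isometry.of_dist_eq fun x y => by simp [dist_eq_norm]
  rw [h1, h2, infDist_smul₀ (kappa_ne_zero hd), Metric.infDist_image hiso, Complex.norm_real,
    Real.norm_eq_abs, abs_of_pos (inv_pos.2 hd)]

/-- Distances to the complement of the image set scale by `d⁻¹` (`σ` is a bijection of the plane). [folklore] -/
theorem infDist_simil_compl (z : ℂ) (A : Set ℂ) :
    Metric.infDist (simil d δ v₀ hd z) (simil d δ v₀ hd '' A)ᶜ = d⁻¹ * Metric.infDist z Aᶜ := by
  rw [← Set.image_compl_eq (simil d δ v₀ hd).bijective, infDist_simil_image]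

/-- The index of the image domain at the image point is the index. [folklore] -/
theorem index_map_simil (D : DobrushinDomain) (z : ℂ) :
    (D.map (simil d δ v₀ hd)).index (simil d δ v₀ hd z) = D.index z := by
  change wind (fun t => (simil d δ v₀ hd ∘ D.boundary) t - simil d δ v₀ hd z) =
    wind fun t => D.boundary t - z
  simp only [Function.comp_apply, simil_sub]
  exact wind_const_mul (kappa_ne_zero hd) _

/-! #### The cell set under the similarity -/

/-- Horizontal offset to a relabelled lattice point, transported. [folklore] -/
theorem simil_re_sub (w : ℂ) (v : Site 2) :
    (simil d δ v₀ hd w).re - (meshPoint (δ * d⁻¹) (v - v₀)).re = d⁻¹ * (w.re - (meshPoint δ v).re) := by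
  simp only [simil_apply_re, meshPoint_re, Pi.sub_apply, Int.cast_sub]; ring

/-- Vertical offset to a relabelled lattice point, transported. [folklore] -/
theorem simil_im_sub (w : ℂ) (v : Site 2) :
    (simil d δ v₀ hd w).im - (meshPoint (δ * d⁻¹) (v - v₀)).im = d⁻¹ * (w.im - (meshPoint δ v).im) := by
  simp only [simil_apply_im, meshPoint_im, Pi.sub_apply, Int.cast_sub]; ring

/-- Horizontal offset to a relabelled face centre, transported. [folklore] -/
theorem simil_re_sub' (w : ℂ) (v : Site 2) :
    (simil d δ v₀ hd w).re - (meshPoint (δ * d⁻¹) (v - v₀)).re - δ * d⁻¹ / 2 =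
      d⁻¹ * (w.re - (meshPoint δ v).re - δ / 2) := by
  simp only [simil_apply_re, meshPoint_re, Pi.sub_apply, Int.cast_sub]; ring

/-- Vertical offset to a relabelled face centre, transported. [folklore] -/
theorem simil_im_sub' (w : ℂ) (v : Site 2) :
    (simil d δ v₀ hd w).im - (meshPoint (δ * d⁻¹) (v - v₀)).im - δ * d⁻¹ / 2 =
      d⁻¹ * (w.im - (meshPoint δ v).im - δ / 2) := by
  simp only [simil_apply_im, meshPoint_im, Pi.sub_apply, Int.cast_sub]; ring

/-- Octagon condition, transported. [folklore] -/
theorem octagon_iff (w : ℂ) (v : Site 2) :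
    (|(simil d δ v₀ hd w).re - (meshPoint (δ * d⁻¹) (v - v₀)).re| ≤ δ * d⁻¹ / 2 ∧
      |(simil d δ v₀ hd w).im - (meshPoint (δ * d⁻¹) (v - v₀)).im| ≤ δ * d⁻¹ / 2 ∧
      |(simil d δ v₀ hd w).re - (meshPoint (δ * d⁻¹) (v - v₀)).re| +
        |(simil d δ v₀ hd w).im - (meshPoint (δ * d⁻¹) (v - v₀)).im| ≤ 9 * (δ * d⁻¹) / 10) ↔
    (|w.re - (meshPoint δ v).re| ≤ δ / 2 ∧ |w.im - (meshPoint δ v).im| ≤ δ / 2 ∧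
      |w.re - (meshPoint δ v).re| + |w.im - (meshPoint δ v).im| ≤ 9 * δ / 10) := by
  have hd' : 0 < d⁻¹ := inv_pos.2 hd
  rw [simil_re_sub, simil_im_sub, abs_mul, abs_mul, abs_of_pos hd', ← mul_add,
    show δ * d⁻¹ / 2 = d⁻¹ * (δ / 2) by ring, show 9 * (δ * d⁻¹) / 10 = d⁻¹ * (9 * δ / 10) by ring,
    mul_le_mul_iff_right₀ hd', mul_le_mul_iff_right₀ hd', mul_le_mul_iff_right₀ hd']

/-- Filler-diamond condition, transported. [folklore] -/
theorem diamond_iff (w : ℂ) (v : Site 2) :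
    (|(simil d δ v₀ hd w).re - (meshPoint (δ * d⁻¹) (v - v₀)).re - δ * d⁻¹ / 2| +
        |(simil d δ v₀ hd w).im - (meshPoint (δ * d⁻¹) (v - v₀)).im - δ * d⁻¹ / 2| ≤ δ * d⁻¹ / 10) ↔
    (|w.re - (meshPoint δ v).re - δ / 2| + |w.im - (meshPoint δ v).im - δ / 2| ≤ δ / 10) := by
  have hd' : 0 < d⁻¹ := inv_pos.2 hd
  rw [simil_re_sub', simil_im_sub', abs_mul, abs_mul, abs_of_pos hd', ← mul_add,
    show δ * d⁻¹ / 10 = d⁻¹ * (δ / 10) by ring, mul_le_mul_iff_right₀ hd']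

/-- Relabelled site sets. [folklore] -/
theorem mem_map_subRight_iff (S : Finset (Site 2)) (x : Site 2) :
    x - v₀ ∈ S.map (Equiv.subRight v₀).toEmbedding ↔ x ∈ S := by
  rw [show x - v₀ = (Equiv.subRight v₀).toEmbedding x from rfl, Finset.mem_map' _]

/-- **The similarity carries the cell set of `S` at mesh `δ` onto the cell set of `S - v₀` at mesh
`δ/d`** (membership form). [folklore] -/
theorem simil_mem_cellSet_iff (S : Finset (Site 2)) (w : ℂ) :
    simil d δ v₀ hd w ∈ cellSet (δ * d⁻¹) (S.map (Equiv.subRight v₀).toEmbedding) ↔ w ∈ cellSet δ S := by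
  simp only [cellSet, Set.mem_union, Set.mem_setOf_eq]
  have reidx : ∀ P : Site 2 → Prop,
      (∃ u ∈ S.map (Equiv.subRight v₀).toEmbedding, P u) ↔ ∃ v ∈ S, P (v - v₀) := by
    intro P
    constructor
    · rintro ⟨u, hu, hP⟩
      obtain ⟨v, hv, rfl⟩ := Finset.mem_map.1 hu
      exact ⟨v, hv, hP⟩
    · rintro ⟨v, hv, hP⟩
      exact ⟨v - v₀, (mem_map_subRight_iff v₀ S v).2 hv, hP⟩
  rw [reidx, reidx]
  refine or_congr (exists_congr fun v => and_congr_right fun _ => octagon_iff hd δ v₀ w v)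
    (exists_congr fun v => and_congr_right fun _ => ?_)
  rw [show v - v₀ + ![1, 0] = v + ![1, 0] - v₀ from sub_add_eq_add_sub v v₀ _,
    show v - v₀ + ![0, 1] = v + ![0, 1] - v₀ from sub_add_eq_add_sub v v₀ _,
    show v - v₀ + ![1, 1] = v + ![1, 1] - v₀ from sub_add_eq_add_sub v v₀ _,
    mem_map_subRight_iff, mem_map_subRight_iff, mem_map_subRight_iff, diamond_iff hd δ v₀ w v]

/-- **The similarity carries the cell set onto the cell set** (set form). [folklore] -/
theorem image_simil_cellSet (S : Finset (Site 2)) :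
    simil d δ v₀ hd '' cellSet δ S = cellSet (δ * d⁻¹) (S.map (Equiv.subRight v₀).toEmbedding) := by
  ext w'
  constructor
  · rintro ⟨w, hw, rfl⟩
    exact (simil_mem_cellSet_iff hd δ v₀ S w).2 hw
  · intro hw'
    refine ⟨(simil d δ v₀ hd).symm w', ?_, (simil d δ v₀ hd).apply_symm_apply w'⟩
    rw [← simil_mem_cellSet_iff hd δ v₀ S, Homeomorph.apply_symm_apply]
    exact hw'

/-- … and cell domains (interiors) onto cell domains. [folklore] -/
theorem image_simil_interior_cellSet (S : Finset (Site 2)) :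
    simil d δ v₀ hd '' interior (cellSet δ S) =
      interior (cellSet (δ * d⁻¹) (S.map (Equiv.subRight v₀).toEmbedding)) := by
  rw [Homeomorph.image_interior, image_simil_cellSet]

/-! #### The discretisation, the SAW law and the side loop under the similarity -/

/-- `δ(-v) = -(δ v)`. [folklore] -/
theorem meshPoint_neg' (v : Site 2) : meshPoint δ (-v) = -meshPoint δ v := by
  rw [meshPoint, meshPoint]
  have : Site.toComplex (-v) = -Site.toComplex v :=
    Complex.ext (by simp [Site.toComplex]) (by simp [Site.toComplex])
  rw [this, mul_neg]

/-- The image of a set under the similarity, as a dilate of a lattice translate. [folklore] -/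
theorem image_simil_eq (Ω : Set ℂ) :
    simil d δ v₀ hd '' Ω =
      (similarity ((d⁻¹ : ℝ) : ℂ) (kappa_ne_zero hd) 0) '' (meshPoint δ (-v₀) +ᵥ Ω) := by
  ext y
  simp only [Set.mem_image, Set.mem_vadd_set, similarity_apply, simil_apply, vadd_eq_add, add_zero,
    meshPoint_neg']
  constructor
  · rintro ⟨x, hx, rfl⟩
    exact ⟨-meshPoint δ v₀ + x, ⟨x, hx, rfl⟩, by ring⟩
  · rintro ⟨_, ⟨x, hx, rfl⟩, rfl⟩
    exact ⟨x, hx, by ring⟩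

/-- **`x ↦ x - v₀` is a graph isomorphism `Ω_δ ≃g (σΩ)_{δ/d}`** for the similarity
`σ : x ↦ (x - δ v₀)/d` (dilation covariance `discreteDomainGraph_dilate` after the lattice translation
`discreteDomainGraph_adj_vadd`). [folklore] -/
theorem discreteDomainGraph_simil_adj (Ω : Set ℂ) (x y : Site 2) :
    (discreteDomainGraph (simil d δ v₀ hd '' Ω) (δ * d⁻¹)).Adj (x - v₀) (y - v₀) ↔
      (discreteDomainGraph Ω δ).Adj x y := by
  rw [image_simil_eq, discreteDomainGraph_dilate (inv_pos.2 hd) (kappa_ne_zero hd) (δ * d⁻¹),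
    show δ * d⁻¹ / d⁻¹ = δ from mul_div_cancel_right₀ δ (inv_ne_zero hd.ne'),
    discreteDomainGraph_adj_vadd]
  simp only [sub_neg_eq_add, sub_add_cancel]

/-- The graph isomorphism `x ↦ x - v₀` from `Ω_δ` onto `(σΩ)_{δ/d}`. [folklore] -/
def similIso (Ω : Set ℂ) :
    discreteDomainGraph Ω δ ≃g discreteDomainGraph (simil d δ v₀ hd '' Ω) (δ * d⁻¹) :=
  ⟨Equiv.subRight v₀, fun {x y} => discreteDomainGraph_simil_adj hd δ v₀ Ω x y⟩

/-- **Transport of the critical SAW law along a graph isomorphism of discretisations**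
(`γ ↦ φ ∘ γ` is a length-preserving bijection of self-avoiding walks). [folklore] -/
theorem law_map_iso {Ω Ω' : Set ℂ} {δ δ' : ℝ}
    (φ : discreteDomainGraph Ω δ ≃g discreteDomainGraph Ω' δ') (a b : Site 2) :
    (SAW.law Ω δ a b).map (fun γ => (⟨γ.walk.map φ.toHom,
        γ.isPath.map (fun _ _ h => φ.injective h)⟩ : SAW.DomainSAW Ω' δ' (φ a) (φ b))) =
      SAW.law Ω' δ' (φ a) (φ b) := by
  have hinj : Function.Injective φ.toHom := fun _ _ h => φ.injective h
  set T : SAW.DomainSAW Ω δ a b → SAW.DomainSAW Ω' δ' (φ a) (φ b) :=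
    fun γ => ⟨γ.walk.map φ.toHom, γ.isPath.map hinj⟩ with hT
  have hTm : Measurable T := SAW.DomainSAW.measurable_of_top _
  have hTbij : Function.Bijective T := by
    refine ⟨fun γ₁ γ₂ h => domainSAW_walk_injective
      (SimpleGraph.Walk.map_injective_of_injective hinj a b (congrArg SAW.DomainSAW.walk h)), ?_⟩
    rintro ⟨q, hq⟩
    refine ⟨⟨(q.map φ.symm.toHom).copy (φ.symm_apply_apply a) (φ.symm_apply_apply b), ?_⟩, ?_⟩
    · rw [SimpleGraph.Walk.isPath_copy]
      exact hq.map fun x y h => φ.symm.injective h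
    · apply domainSAW_walk_injective
      apply SimpleGraph.Walk.support_injective
      change (((q.map φ.symm.toHom).copy _ _).map φ.toHom).support = q.support
      rw [SimpleGraph.Walk.support_map, SimpleGraph.Walk.support_copy,
        SimpleGraph.Walk.support_map, List.map_map]
      conv_rhs => rw [← List.map_id q.support]
      exact List.map_congr_left fun x _ => φ.apply_symm_apply x
  have hlen : ∀ γ, (T γ).length = γ.length := fun γ => SimpleGraph.Walk.length_map _ _
  have hweight : (SAW.weight Ω δ a b).map T = SAW.weight Ω' δ' (φ a) (φ b) := by
    rw [SAW.weight, Measure.map_sum hTm.aemeasurable]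
    simp only [Measure.map_smul, Measure.map_dirac' hTm]
    rw [SAW.weight, ← Measure.sum_comp_equiv (Equiv.ofBijective T hTbij)]
    congr 1
    funext γ
    simp only [Function.comp_apply, Equiv.ofBijective_apply, hlen]
  rw [SAW.law, Measure.map_smul, hweight, SAW.law, ← hweight,
    Measure.map_apply hTm MeasurableSet.univ, Set.preimage_univ]

/-- The SAW of `(σD)_{δ/d}` corresponding to a SAW of `D_δ` under `x ↦ x - v₀`. [folklore] -/
def mapSAW (D : DobrushinDomain) (p q : Site 2) (γ : SAW.DomainSAW D.carrier δ p q) :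
    SAW.DomainSAW (D.map (simil d δ v₀ hd)).carrier (δ * d⁻¹) (p - v₀) (q - v₀) :=
  ⟨γ.walk.map (similIso hd δ v₀ D.carrier).toHom,
    γ.isPath.map (fun _ _ h => (similIso hd δ v₀ D.carrier).injective h)⟩

/-- **The side loop is transported pointwise**: the loop of the image walk in the image domain is the
image of the loop. [folklore] -/
theorem sideLoop_mapSAW (D : DobrushinDomain) (p q : Site 2) (γ : SAW.DomainSAW D.carrier δ p q)
    (t : ℝ) :
    sideLoop (δ * d⁻¹) (p - v₀) (q - v₀) (D.map (simil d δ v₀ hd)) (mapSAW hd δ v₀ D p q γ) t =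
      simil d δ v₀ hd (sideLoop δ p q D γ t) := by
  simp only [sideLoop, mapSAW]
  split_ifs with h1 h2 h3
  · exact toCurve_map_apply (similIso hd δ v₀ D.carrier).toHom (meshPoint δ) (meshPoint (δ * d⁻¹))
      (simil d δ v₀ hd) (similarity_lineMap _ _ _) (fun x => simil_meshPoint hd δ v₀ x) γ.walk _
  · rw [MarkedDomain.pt_map, ← simil_meshPoint]
    exact simil_affine hd δ v₀ _ _ _
  · rfl
  · rw [MarkedDomain.pt_map, ← simil_meshPoint]
    exact simil_affine hd δ v₀ _ _ _

/-- **Exact similarity covariance of the side field at every mesh.** [folklore] -/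
theorem sideVal_simil (D : DobrushinDomain) (p q : Site 2) (x : ℂ) :
    sideVal (δ * d⁻¹) (p - v₀) (q - v₀) (D.map (simil d δ v₀ hd)) (simil d δ v₀ hd x) =
      sideVal δ p q D x := by
  unfold sideVal
  have hlaw := law_map_iso (similIso hd δ v₀ D.carrier) p q
  change (SAW.law (simil d δ v₀ hd '' D.carrier) (δ * d⁻¹) (similIso hd δ v₀ D.carrier p)
    (similIso hd δ v₀ D.carrier q)
    {γ' | wind (fun t => sideLoop (δ * d⁻¹) (p - v₀) (q - v₀) (D.map (simil d δ v₀ hd)) γ' t -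
      simil d δ v₀ hd x) ≠ 0}).toReal = _
  rw [← hlaw, Measure.map_apply (SAW.DomainSAW.measurable_of_top _) MeasurableSpace.measurableSet_top]
  congr 2
  ext γ
  simp only [Set.mem_preimage, Set.mem_setOf_eq]
  have key : (fun t => sideLoop (δ * d⁻¹) (p - v₀) (q - v₀) (D.map (simil d δ v₀ hd))
      (mapSAW hd δ v₀ D p q γ) t - simil d δ v₀ hd x) =
      fun t => ((d⁻¹ : ℝ) : ℂ) * (sideLoop δ p q D γ t - x) := by
    funext t
    rw [sideLoop_mapSAW, simil_sub]
  change wind (fun t => sideLoop (δ * d⁻¹) (p - v₀) (q - v₀) (D.map (simil d δ v₀ hd))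
      (mapSAW hd δ v₀ D p q γ) t - simil d δ v₀ hd x) ≠ 0 ↔ _
  rw [key, wind_const_mul (kappa_ne_zero hd)]

/-! #### The chordal uniformizer of the image domain -/

/-- The uniformizer `σ ∘ Φ : ℍ → σD` of the image domain. [folklore] -/
def mapUnif (D : DobrushinDomain) (Φ : ConformalEquiv UpperHalfPlane.upperHalfPlaneSet D.carrier) :
    ConformalEquiv UpperHalfPlane.upperHalfPlaneSet (D.map (simil d δ v₀ hd)).carrier :=
  Φ.trans (ChordalFamily.similarityConformalEquiv ((d⁻¹ : ℝ) : ℂ) (kappa_ne_zero hd)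
    (-(((d⁻¹ : ℝ) : ℂ) * meshPoint δ v₀)) D.carrier)

/-- The inverse uniformizer of the image domain is `Φ⁻¹ ∘ σ⁻¹`. [folklore] -/
theorem mapUnif_symm_apply (D : DobrushinDomain)
    (Φ : ConformalEquiv UpperHalfPlane.upperHalfPlaneSet D.carrier) (y : ℂ) :
    (mapUnif hd δ v₀ D Φ).symm y = Φ.symm ((simil d δ v₀ hd).symm y) := rfl

/-- `σ ∘ Φ` is again chordal (`σ` is continuous on the plane). [folklore] -/
theorem isChordalUniformizing_mapUnif (D : DobrushinDomain)
    (Φ : ConformalEquiv UpperHalfPlane.upperHalfPlaneSet D.carrier) (h : D.IsChordalUniformizing Φ) :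
    (D.map (simil d δ v₀ hd)).IsChordalUniformizing (mapUnif hd δ v₀ D Φ) :=
  ⟨((simil d δ v₀ hd).continuous.tendsto (D.pt 0)).comp h.1,
    ((simil d δ v₀ hd).continuous.tendsto (D.pt 1)).comp h.2⟩

end Similarity

/-! ### The assembly -/

/-- **The typed split of the crux `ClosureToSchramm`** (stmt-CriticalPhenomena-5597): Schrödinger
stability (pure analysis, hypothesis 1 = child `SchrodingerStability`), boundary values of the side
field near the arcs (hypothesis 2 = child `ArcBoundaryValues`) and macroscopic equicontinuity of the
side field (hypothesis 3 = child `SideFieldEquicontinuity`) imply `TurningClosure → SchrammPassageUniform`,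
by normalising each cell configuration with a lattice similarity, applying the three uniform
hypotheses and the turning closure to the normalised configuration, and transporting the bound back by
exact similarity covariance of the side field. The three hypotheses are verbatim the children filed
with `route edit --split ClosureToSchramm`. [folklore] -/
theorem closureToSchramm_of_subs :
    (∀ (ηB : ℝ → ℝ) (NB : ℝ → ℕ) (ρE : ℝ → ℝ) (NE : ℝ → ℕ), (∀ e > (0 : ℝ), 0 < ηB e) → (∀ e > (0 : ℝ), 0 < ρE e) → ∀ ε > (0 : ℝ), ∃ (m : ℕ) (ψ : Fin m → ℂ → ℝ) (r η : ℝ) (N : ℕ), (∀ i, ContDiff ℝ 2 (ψ i)) ∧ (∀ i, HasCompactSupport (ψ i)) ∧ 0 < r ∧ 0 < η ∧ ∀ (δ : ℝ) (D : Literature.Probability.RandomPlanarGeometry.DobrushinDomain) (Φ : Literature.Probability.RandomPlanarGeometry.ConformalEquiv UpperHalfPlane.upperHalfPlaneSet D.carrier) (z : ℂ) (H : ℂ → ℝ), let c : Literature.Probability.LatticeModels.Site 2 → ℂ := fun f => Literature.Probability.LatticeModels.meshPoint δ f + ((δ / 2 : ℝ) : ℂ) * (1 + Complex.I); let ω : ℂ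 → ℝ := fun w => Complex.arg (Φ.symm w) / Real.pi; let E : Literature.Probability.LatticeModels.Site 2 → ℝ := fun f => Real.pi ^ 2 * ((ω (c (f + ![1, 0])) - ω (c f)) ^ 2 + (ω (c (f + ![0, 1])) - ω (c f)) ^ 2); let s : ℂ → ℝ := fun x => (1 - (D.index x : ℝ) * ((Φ.symm x).re / ‖Φ.symm x‖)) / 2; 0 < δ → z ∈ D.carrier → ‖z‖ ≤ δ → Metric.infDist z D.carrierᶜ = 1 → (N : ℝ) * δ ≤ 1 → ‖Φ.symm z‖ = 1 → (∀ x, 0 ≤ H x ∧ H x ≤ 1) → (∀ e > (0 : ℝ), ∀ x ∈ D.carrier, (NB e : ℝ) * δ ≤ Metric.infDist x D.carrierᶜ → (Complex.arg (Φ.symm x) ≤ ηB e ∨ Real.pi - ηB e ≤ Complex.arg (Φ.symm x)) → |H x - s x| ≤ e) → (∀ e > (0 : ℝ), ∀ x x' : ℂ, x ∈ D.carrier → (NE e : ℝ) * δ ≤ Metric.infDist x D.carrierᶜ → ‖x' - x‖ ≤ ρE e * Metric.infDist x D.carrierᶜ → |H x - H x'| ≤ e) → (∀ i : Fin m, Metric.cthickening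 r (tsupport (ψ i)) ⊆ D.carrier → |∑' f : Literature.Probability.LatticeModels.Site 2, (H (c f) * Literature.Probability.LatticeModels.latticeLaplacian (fun g => ψ i (c g)) f + (1 / 2) * ψ i (c f) * E f * (2 * H (c f) - 1))| ≤ η) → |H z - (1 - (D.index z : ℝ) * (Φ.symm z).re) / 2| ≤ ε) →
    (∀ e > (0 : ℝ), ∃ η > (0 : ℝ), ∃ N : ℕ, ∀ (δ : ℝ) (S : Finset (Literature.Probability.LatticeModels.Site 2)) (p p' q q' : Literature.Probability.LatticeModels.Site 2) (D : Literature.Probability.RandomPlanarGeometry.DobrushinDomain) (Φ : Literature.Probability.RandomPlanarGeometry.ConformalEquiv UpperHalfPlane.upperHalfPlaneSet D.carrier) (x : ℂ), let L : Literature.Probability.RandomPlanarGeometry.SAW.DomainSAW D.carrier δ p q → ℝ → ℂ := fun γ t => if t ≤ 1 / 2 then (γ.walk.toCurve (Literature.Probability.LatticeModels.meshPoint δ)) (Set.projIcc (0 : ℝ) 1 zero_le_one (2 * t)) else if 2 * t - 1 ≤ 1 / 3 then Literature.Probability.LatticeModels.meshPoint δ q + ((3 * (2 * t - 1) : ℝ)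 : ℂ) * (D.pt 1 - Literature.Probability.LatticeModels.meshPoint δ q) else if 2 * t - 1 ≤ 2 / 3 then D.boundary (D.mark 1 + (3 * (2 * t - 1) - 1) * (D.mark 0 + 1 - D.mark 1)) else D.pt 0 + ((3 * (2 * t - 1) - 2 : ℝ) : ℂ) * (Literature.Probability.LatticeModels.meshPoint δ p - D.pt 0); 0 < δ → p ∈ S → q ∈ S → p' ∉ S → q' ∉ S → (Literature.Probability.LatticeModels.zdGraph 2).Adj p p' → (Literature.Probability.LatticeModels.zdGraph 2).Adj q q' → D.carrier = interior ({w : ℂ | ∃ v ∈ S, |w.re - (Literature.Probability.LatticeModels.meshPoint δ v).re| ≤ δ / 2 ∧ |w.im - (Literature.Probability.LatticeModels.meshPoint δ v).im| ≤ δ / 2 ∧ |w.re - (Literature.Probability.LatticeModels.meshPoint δ v).re| + |w.im - (Literature.Probability.LatticeModels.meshPoint δ v).im| ≤ 9 * δ / 10} ∪ {w : ℂ | ∃ v ∈ S, v + ![1, 0] ∈ S ∧ v + ![0, 1] ∈ S ∧ v + ![1, 1] ∈ S ∧ |w.re - (Literature.Probability.LatticeModels.meshPoint δ v).re - δ / 2|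 + |w.im - (Literature.Probability.LatticeModels.meshPoint δ v).im - δ / 2| ≤ δ / 10}) → D.pt 0 = (Literature.Probability.LatticeModels.meshPoint δ p + Literature.Probability.LatticeModels.meshPoint δ p') / 2 → D.pt 1 = (Literature.Probability.LatticeModels.meshPoint δ q + Literature.Probability.LatticeModels.meshPoint δ q') / 2 → D.IsChordalUniformizing Φ → x ∈ D.carrier → (N : ℝ) * δ ≤ Metric.infDist x D.carrierᶜ → (Complex.arg (Φ.symm x) ≤ η ∨ Real.pi - η ≤ Complex.arg (Φ.symm x)) → |(Literature.Probability.RandomPlanarGeometry.SAW.law D.carrier δ p q {γ | Literature.Topology.PlaneTopology.wind (fun t => L γ t - x) ≠ 0}).toReal - (1 - (D.index x : ℝ) * ((Φ.symm x).re / ‖Φ.symm x‖)) / 2| ≤ e) →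
    (∀ e > (0 : ℝ), ∃ ρ > (0 : ℝ), ∃ N : ℕ, ∀ (δ : ℝ) (S : Finset (Literature.Probability.LatticeModels.Site 2)) (p p' q q' : Literature.Probability.LatticeModels.Site 2) (D : Literature.Probability.RandomPlanarGeometry.DobrushinDomain) (Φ : Literature.Probability.RandomPlanarGeometry.ConformalEquiv UpperHalfPlane.upperHalfPlaneSet D.carrier) (x x' : ℂ), let L : Literature.Probability.RandomPlanarGeometry.SAW.DomainSAW D.carrier δ p q → ℝ → ℂ := fun γ t => if t ≤ 1 / 2 then (γ.walk.toCurve (Literature.Probability.LatticeModels.meshPoint δ)) (Set.projIcc (0 : ℝ) 1 zero_le_one (2 * t)) else if 2 * t - 1 ≤ 1 / 3 then Literature.Probability.LatticeModels.meshPoint δ q + ((3 * (2 * t - 1) : ℝ) : ℂ) * (D.pt 1 - Literature.Probability.LatticeModels.meshPoint δ q) else if 2 * t - 1 ≤ 2 / 3 then D.boundary (D.mark 1 + (3 * (2 * t - 1) - 1) * (D.mark 0 + 1 - D.mark 1)) else D.pt 0 + ((3 * (2 * t - 1) - 2 : ℝ) : ℂ) * (Literature.Probability.LatticeModels.meshPoint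 δ p - D.pt 0); 0 < δ → p ∈ S → q ∈ S → p' ∉ S → q' ∉ S → (Literature.Probability.LatticeModels.zdGraph 2).Adj p p' → (Literature.Probability.LatticeModels.zdGraph 2).Adj q q' → D.carrier = interior ({w : ℂ | ∃ v ∈ S, |w.re - (Literature.Probability.LatticeModels.meshPoint δ v).re| ≤ δ / 2 ∧ |w.im - (Literature.Probability.LatticeModels.meshPoint δ v).im| ≤ δ / 2 ∧ |w.re - (Literature.Probability.LatticeModels.meshPoint δ v).re| + |w.im - (Literature.Probability.LatticeModels.meshPoint δ v).im| ≤ 9 * δ / 10} ∪ {w : ℂ | ∃ v ∈ S, v + ![1, 0] ∈ S ∧ v + ![0, 1] ∈ S ∧ v + ![1, 1] ∈ S ∧ |w.re - (Literature.Probability.LatticeModels.meshPoint δ v).re - δ / 2| + |w.im - (Literature.Probability.LatticeModels.meshPoint δ v).im - δ / 2| ≤ δ / 10}) → D.pt 0 = (Literature.Probability.LatticeModels.meshPoint δ p + Literature.Probability.LatticeModels.meshPoint δ p') / 2 → D.pt 1 = (Literature.Probability.LatticeModels.meshPoint δ q + Literature.Probability.LatticeModels.meshPoint δ q') / 2 →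 D.IsChordalUniformizing Φ → x ∈ D.carrier → (N : ℝ) * δ ≤ Metric.infDist x D.carrierᶜ → ‖x' - x‖ ≤ ρ * Metric.infDist x D.carrierᶜ → |(Literature.Probability.RandomPlanarGeometry.SAW.law D.carrier δ p q {γ | Literature.Topology.PlaneTopology.wind (fun t => L γ t - x) ≠ 0}).toReal - (Literature.Probability.RandomPlanarGeometry.SAW.law D.carrier δ p q {γ | Literature.Topology.PlaneTopology.wind (fun t => L γ t - x') ≠ 0}).toReal| ≤ e) →
    ClosureToSchramm := by
  intro hA hB hE hTC ε hε
  classical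
  -- (1) the moduli of the boundary-value and equicontinuity estimates, as functions of the tolerance
  choose! ηB hηB NB hBmain using hB
  choose! ρE hρE NE hEmain using hE
  -- (2) the finite test data of the stability statement for these moduli
  obtain ⟨m, ψ, r, η, N₀, hψ2, hψc, hr, hη, hAmain⟩ := hA ηB NB ρE NE hηB hρE ε hε
  -- (3) the turning closure for each of the finitely many test functions
  have hTCi : ∀ i : Fin m, ∃ δ₀ > (0 : ℝ), _ := fun i => hTC (ψ i) (hψ2 i) (hψc i) η hη r hr
  choose δ₀ hδ₀ hTCmain using hTCi
  -- (4) the uniform number of cells of room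
  refine ⟨N₀ + 1 + ∑ i, ⌈(δ₀ i)⁻¹⌉₊, ?_⟩
  intro δ S p p' q q' D Φ z L hδ hp hq hp' hq' hpp' hqq' hcar hpt0 hpt1 hΦ hz hroom hnorm
  set N : ℕ := N₀ + 1 + ∑ i, ⌈(δ₀ i)⁻¹⌉₊ with hNdef
  have hNcast : (N : ℝ) = N₀ + 1 + ∑ i, (⌈(δ₀ i)⁻¹⌉₊ : ℝ) := by
    rw [hNdef]; push_cast; ring
  have hsum_nonneg : (0 : ℝ) ≤ ∑ i, (⌈(δ₀ i)⁻¹⌉₊ : ℝ) := Finset.sum_nonneg fun i _ => by positivity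
  have hN0 : (N₀ : ℝ) ≤ N := by rw [hNcast]; linarith
  have hN1 : (1 : ℝ) ≤ N := by rw [hNcast]; linarith [(Nat.cast_nonneg N₀ : (0 : ℝ) ≤ N₀)]
  have hNi : ∀ i, (δ₀ i)⁻¹ ≤ N := by
    intro i
    have h1 : (δ₀ i)⁻¹ ≤ (⌈(δ₀ i)⁻¹⌉₊ : ℝ) := Nat.le_ceil _
    have h2 : (⌈(δ₀ i)⁻¹⌉₊ : ℝ) ≤ ∑ j, (⌈(δ₀ j)⁻¹⌉₊ : ℝ) :=
      Finset.single_le_sum (f := fun j => (⌈(δ₀ j)⁻¹⌉₊ : ℝ)) (fun j _ => by positivity)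
        (Finset.mem_univ i)
    rw [hNcast]; linarith [(Nat.cast_nonneg N₀ : (0 : ℝ) ≤ N₀)]
  -- (5) the distance to the boundary `d ≥ N δ > 0` and the nearest lattice site to `z`
  set d : ℝ := Metric.infDist z D.carrierᶜ with hd_def
  have hNδ : 0 < (N : ℝ) * δ := mul_pos (lt_of_lt_of_le one_pos hN1) hδ
  have hdpos : 0 < d := lt_of_lt_of_le hNδ hroom
  set v₀ : Site 2 := nearestSite δ z with hv₀
  -- (6) the normalised configuration: similarity `σ x = (x - δ v₀) / d`
  set δ'' : ℝ := δ * d⁻¹ with hδ''def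
  set S'' : Finset (Site 2) := S.map (Equiv.subRight v₀).toEmbedding with hS''
  have hδ'' : 0 < δ'' := mul_pos hδ (inv_pos.2 hdpos)
  have hp'' : p - v₀ ∈ S'' := (mem_map_subRight_iff v₀ S p).2 hp
  have hq'' : q - v₀ ∈ S'' := (mem_map_subRight_iff v₀ S q).2 hq
  have hpn : p' - v₀ ∉ S'' := fun h => hp' ((mem_map_subRight_iff v₀ S p').1 h)
  have hqn : q' - v₀ ∉ S'' := fun h => hq' ((mem_map_subRight_iff v₀ S q').1 h)
  have hadjp : (zdGraph 2).Adj (p - v₀) (p' - v₀) := by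
    have := (zdGraph_adj_shift_iff (-v₀) p p').2 hpp'
    simpa only [Site.shift_apply, ← sub_eq_add_neg] using this
  have hadjq : (zdGraph 2).Adj (q - v₀) (q' - v₀) := by
    have := (zdGraph_adj_shift_iff (-v₀) q q').2 hqq'
    simpa only [Site.shift_apply, ← sub_eq_add_neg] using this
  have hcar'' : (D.map (simil d δ v₀ hdpos)).carrier = interior (cellSet δ'' S'') := by
    change simil d δ v₀ hdpos '' D.carrier = _
    rw [hcar]
    exact image_simil_interior_cellSet hdpos δ v₀ S
  have hpt0'' : (D.map (simil d δ v₀ hdpos)).pt 0 =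
      (meshPoint δ'' (p - v₀) + meshPoint δ'' (p' - v₀)) / 2 := by
    change simil d δ v₀ hdpos (D.pt 0) = _
    rw [hpt0, ← simil_meshPoint hdpos, ← simil_meshPoint hdpos, simil_apply, simil_apply, simil_apply]
    ring
  have hpt1'' : (D.map (simil d δ v₀ hdpos)).pt 1 =
      (meshPoint δ'' (q - v₀) + meshPoint δ'' (q' - v₀)) / 2 := by
    change simil d δ v₀ hdpos (D.pt 1) = _
    rw [hpt1, ← simil_meshPoint hdpos, ← simil_meshPoint hdpos, simil_apply, simil_apply, simil_apply]
    ring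
  have hΦ'' := isChordalUniformizing_mapUnif hdpos δ v₀ D Φ hΦ
  have hz'' : simil d δ v₀ hdpos z ∈ (D.map (simil d δ v₀ hdpos)).carrier := Set.mem_image_of_mem _ hz
  have hzn : ‖simil d δ v₀ hdpos z‖ ≤ δ'' := by
    rw [simil_apply, norm_mul, Complex.norm_real, Real.norm_eq_abs, abs_of_pos (inv_pos.2 hdpos),
      ← dist_eq_norm, dist_comm, hδ''def, mul_comm δ]
    exact mul_le_mul_of_nonneg_left (dist_meshPoint_nearestSite_le hδ z) (inv_pos.2 hdpos).le
  have hdist : Metric.infDist (simil d δ v₀ hdpos z) (D.map (simil d δ v₀ hdpos)).carrierᶜ = 1 := by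
    change Metric.infDist (simil d δ v₀ hdpos z) (simil d δ v₀ hdpos '' D.carrier)ᶜ = 1
    rw [infDist_simil_compl, ← hd_def, inv_mul_cancel₀ hdpos.ne']
  have hδ''N : δ'' * N ≤ 1 := by
    rw [hδ''def, mul_assoc, mul_comm d⁻¹, ← mul_assoc, ← div_eq_mul_inv, div_le_one hdpos, mul_comm]
    exact hroom
  have hN'' : (N₀ : ℝ) * δ'' ≤ 1 :=
    le_trans (by rw [mul_comm]; exact mul_le_mul_of_nonneg_left hN0 hδ''.le) hδ''N
  have hδle : ∀ i, δ'' ≤ δ₀ i := by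
    intro i
    have h1 : δ'' ≤ (N : ℝ)⁻¹ := by
      rw [le_inv_comm₀ hδ'' (lt_of_lt_of_le one_pos hN1)]
      calc (N : ℝ) = N * 1 := (mul_one _).symm
        _ ≤ N * (δ''⁻¹ * δ'') := by rw [inv_mul_cancel₀ hδ''.ne']
        _ = (δ'' * N) * δ''⁻¹ := by ring
        _ ≤ 1 * δ''⁻¹ := mul_le_mul_of_nonneg_right hδ''N (inv_pos.2 hδ'').le
        _ = δ''⁻¹ := one_mul _
    have h2 : (N : ℝ)⁻¹ ≤ δ₀ i := by
      have := inv_anti₀ (inv_pos.2 (hδ₀ i)) (hNi i)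
      rwa [inv_inv] at this
    exact h1.trans h2
  have hΦz : (mapUnif hdpos δ v₀ D Φ).symm (simil d δ v₀ hdpos z) = Φ.symm z := by
    rw [mapUnif_symm_apply, Homeomorph.symm_apply_apply]
  have hnorm'' : ‖(mapUnif hdpos δ v₀ D Φ).symm (simil d δ v₀ hdpos z)‖ = 1 := by
    rw [hΦz]; exact hnorm
  -- (7) the hypotheses of the stability statement for the side field of the normalised configuration
  have h01 : ∀ x, 0 ≤ sideVal δ'' (p - v₀) (q - v₀) (D.map (simil d δ v₀ hdpos)) x ∧
      sideVal δ'' (p - v₀) (q - v₀) (D.map (simil d δ v₀ hdpos)) x ≤ 1 :=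
    fun x => sideVal_mem _ _ _ _ x
  have hBH : ∀ e > (0 : ℝ), ∀ x ∈ (D.map (simil d δ v₀ hdpos)).carrier,
      (NB e : ℝ) * δ'' ≤ Metric.infDist x (D.map (simil d δ v₀ hdpos)).carrierᶜ →
      (Complex.arg ((mapUnif hdpos δ v₀ D Φ).symm x) ≤ ηB e ∨
        Real.pi - ηB e ≤ Complex.arg ((mapUnif hdpos δ v₀ D Φ).symm x)) →
      |sideVal δ'' (p - v₀) (q - v₀) (D.map (simil d δ v₀ hdpos)) x -
        (1 - ((D.map (simil d δ v₀ hdpos)).index x : ℝ) *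
          (((mapUnif hdpos δ v₀ D Φ).symm x).re / ‖(mapUnif hdpos δ v₀ D Φ).symm x‖)) / 2| ≤ e :=
    fun e he x hx h1 h2 => hBmain e he δ'' S'' (p - v₀) (p' - v₀) (q - v₀) (q' - v₀)
      (D.map (simil d δ v₀ hdpos)) (mapUnif hdpos δ v₀ D Φ) x hδ'' hp'' hq'' hpn hqn hadjp hadjq
      hcar'' hpt0'' hpt1'' hΦ'' hx h1 h2
  have hEH : ∀ e > (0 : ℝ), ∀ x x' : ℂ, x ∈ (D.map (simil d δ v₀ hdpos)).carrier →
      (NE e : ℝ) * δ'' ≤ Metric.infDist x (D.map (simil d δ v₀ hdpos)).carrierᶜ →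
      ‖x' - x‖ ≤ ρE e * Metric.infDist x (D.map (simil d δ v₀ hdpos)).carrierᶜ →
      |sideVal δ'' (p - v₀) (q - v₀) (D.map (simil d δ v₀ hdpos)) x -
        sideVal δ'' (p - v₀) (q - v₀) (D.map (simil d δ v₀ hdpos)) x'| ≤ e :=
    fun e he x x' hx h1 h2 => hEmain e he δ'' S'' (p - v₀) (p' - v₀) (q - v₀) (q' - v₀)
      (D.map (simil d δ v₀ hdpos)) (mapUnif hdpos δ v₀ D Φ) x x' hδ'' hp'' hq'' hpn hqn hadjp hadjq
      hcar'' hpt0'' hpt1'' hΦ'' hx h1 h2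
  have hTCH : ∀ i : Fin m, Metric.cthickening r (tsupport (ψ i)) ⊆ (D.map (simil d δ v₀ hdpos)).carrier →
      |∑' f : Site 2, (sideVal δ'' (p - v₀) (q - v₀) (D.map (simil d δ v₀ hdpos))
          (meshPoint δ'' f + ((δ'' / 2 : ℝ) : ℂ) * (1 + Complex.I)) *
        latticeLaplacian (fun g => ψ i (meshPoint δ'' g + ((δ'' / 2 : ℝ) : ℂ) * (1 + Complex.I))) f +
        (1 / 2) * ψ i (meshPoint δ'' f + ((δ'' / 2 : ℝ) : ℂ) * (1 + Complex.I)) *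
          (Real.pi ^ 2 * ((Complex.arg ((mapUnif hdpos δ v₀ D Φ).symm
              (meshPoint δ'' (f + ![1, 0]) + ((δ'' / 2 : ℝ) : ℂ) * (1 + Complex.I))) / Real.pi -
            Complex.arg ((mapUnif hdpos δ v₀ D Φ).symm
              (meshPoint δ'' f + ((δ'' / 2 : ℝ) : ℂ) * (1 + Complex.I))) / Real.pi) ^ 2 +
            (Complex.arg ((mapUnif hdpos δ v₀ D Φ).symm
              (meshPoint δ'' (f + ![0, 1]) + ((δ'' / 2 : ℝ) : ℂ) * (1 + Complex.I))) / Real.pi -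
            Complex.arg ((mapUnif hdpos δ v₀ D Φ).symm
              (meshPoint δ'' f + ((δ'' / 2 : ℝ) : ℂ) * (1 + Complex.I))) / Real.pi) ^ 2)) *
          (2 * sideVal δ'' (p - v₀) (q - v₀) (D.map (simil d δ v₀ hdpos))
            (meshPoint δ'' f + ((δ'' / 2 : ℝ) : ℂ) * (1 + Complex.I)) - 1))| ≤ η :=
    fun i hsupp => hTCmain i δ'' S'' (p - v₀) (p' - v₀) (q - v₀) (q' - v₀)
      (D.map (simil d δ v₀ hdpos)) (mapUnif hdpos δ v₀ D Φ) ⟨hδ'', hδle i⟩ hp'' hq'' hpn hqn hadjp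
      hadjq hcar'' hpt0'' hpt1'' hΦ'' hsupp
  -- (8) the stability statement, applied to the normalised side field
  have key := hAmain δ'' (D.map (simil d δ v₀ hdpos)) (mapUnif hdpos δ v₀ D Φ) (simil d δ v₀ hdpos z)
    (sideVal δ'' (p - v₀) (q - v₀) (D.map (simil d δ v₀ hdpos))) hδ'' hz'' hzn hdist hN'' hnorm'' h01
    hBH hEH hTCH
  -- (9) back to the original configuration: exact similarity covariance of the side field, the index
  -- and the uniformizing coordinate
  rw [sideVal_simil hdpos δ v₀ D p q z, index_map_simil hdpos δ v₀ D z, hΦz] at key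
  exact key

end Summit.CriticalPhenomena.SAWScalingLimit.Theorems.ClosureToSchrammSplit

end
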